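import Mathlib.Topology.Instances.ZMod
import Literature.NumberTheory.GaloisRepresentations.ContinuousH2
import Literature.NumberTheory.GaloisRepresentations.ContinuousShapiroLift
import HarnessLib

/-!
# The carry `2`-cocycle of a quadratic character of an open subgroup, and its diagonal at an
# involution

Generic continuous group cohomology (no number theory).  Let `G` be a topological group, `X` a
topological `G`-module (`X : TopRep R G`), `N ≤ G` an open subgroup of finite index with a system
`s` of left coset representatives (`s(x) N = x`), `m ∈ X` a vector FIXED by `N`, and
`χ : N → {±1} = ℤ/2` a quadratic character of `N`.  Writing
`e(g, x) = χ(s(g • x)⁻¹ g s(x)) ∈ ℤ/2` for the sign of the Schreier element of `g` at the coset `x`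
(the tree's `schreierElt`, file `EllipticCurves/PeriodIndexCorestriction.lean`; cocycle rule
`e(g₁ g₂, x) = e(g₁, g₂ • x) + e(g₂, x)`), the **carry cocycle** is the continuous inhomogeneous
`2`-cocycle

  `X_{χ,m}(g, h) = ∑_{x ∈ G/N} carry(e(g, h • x), e(h, x)) · s(g h • x) m`,   `carry(a, b) = [a = b = 1]`.

It is the image of the Bockstein `δ χ ∈ H²(N, ℤ/#)` of `χ` (sequence `ℤ/# → ℤ/2# → ℤ/2`) under
`(n ↦ n m)_*` followed by corestriction `H²(N, X) → H²(G, X)` — equivalently the image under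
`Φ : Maps(G/N, ℤ) → X`, `f ↦ ∑ f(x) s(x) m`, of the carry cocycle of the Shapiro lift of `χ` — written
out on inhomogeneous cochains (Neukirch–Schmidt–Wingberg I §5 (cor via coset representatives), I §6
(Shapiro), and the "carry" description of the Bockstein of a character, Serre *Corps locaux* VIII §4 /
XIV §1).  This file needs none of those intermediate objects: the cocycle identity is the
associativity of carrying, `carry(b,d) + carry(a, b+d) = carry(a+b, d) + carry(a, b)`, summed over
the cosets (`bitCarry_assoc`, `schreierCarryCocycle`).

Main results (all proved):

* `bitCarry`, `bitCarry_assoc` — the carry of two bits and its associativity law;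
* `schreierSign N hs χ g x = χ(schreierElt g x)` read in `ℤ/2`, `schreierSign_mul` (cocycle rule),
  `schreierSign_one`;
* `schreierCarryCocycle X N hN hs χ hχ m hm : contTwoCocycles X` — the carry cocycle (`N` open, `χ`
  continuous, `m` fixed by `N`), `schreierCarryCocycle_apply`, `schreierCarryCocycle_one_one` (`X(1,1) = 0`);
* **the diagonal at an involution** `c` (`c * c = 1`): `schreierCarryCocycle_apply_self` —
  `X(c, c) = ∑_{x : e(c,x) = 1} s(x) m`; `exists_sum_eq_add_of_involutive` — a sum over a finite set
  stable under a fixed-point-free involution `τ` of terms with `f(τ x) = T(f x)` is of the form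
  `y + T y`; hence `schreierCarryCocycle_diag_eq_sum_fixed_add` —
  `X(c, c) = ∑_{x : c • x = x, e(c,x) = 1} s(x) m + (y + c y)`, with the two readings used by the
  Poitou–Tate real-places surjectivity (`GaloisCohomology/PoitouTateTwoRealPlacesSurjectiveHolds`):
  `schreierCarryCocycle_diag_of_forall_fixed` (all fixed cosets have sign `0` ⇒ `X(c,c) ∈ (1 + c) X`) and
  `schreierCarryCocycle_diag_of_unit` (`c ∈ N`, sign `1` at the unit coset only ⇒ `X(c,c) ∈ m + (1 + c) X`).

## References

* J. Neukirch, A. Schmidt, K. Wingberg, *Cohomology of Number Fields*, 2nd ed. (2008), I §5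
  (corestriction on inhomogeneous cochains via coset representatives), I §6 (Shapiro's lemma).
  [NeukirchSchmidtWingberg2008]
* J.-P. Serre, *Corps locaux* / *Local Fields* (1979), VII §8 (transfer, Schreier elements),
  VIII §4 (cohomology of cyclic groups). [SerreLocalFields1979]

## Design notes

* `χ` is a bare `N →* Multiplicative (ZMod 2)` with a separate continuity hypothesis; the carry is
  `ℕ`-valued and acts by `nsmul`, so that the cocycle identity is an identity of natural numbers
  decided by `decide` and no `2`-torsion hypothesis on `m` is needed.
* `[Fintype (G ⧸ N)]` is an explicit instance argument (for `G` compact and `N` open it is supplied by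
  `Subgroup.quotient_finite_of_isOpen`).
* No instance, no notation, no named fact.
-/

noncomputable section

open CategoryTheory

universe u v

namespace Literature.NumberTheory.GaloisRepresentations

open Literature.NumberTheory.EllipticCurves (schreierElt schreierElt_mem schreierElt_coe
  rep_mul_schreierElt schreierElt_mul)
open TopRep

/-! ### The carry of two bits -/

/-- The **carry** of the addition of two bits: `1` if `a = b = 1`, else `0` (as a natural number).
Ref: Serre, *Corps locaux* XIV §1 (Witt vectors / carrying); here only the `2`-bit case. [folklore] -/
def bitCarry (a b : ZMod 2) : ℕ :=
  if a = 1 ∧ b = 1 then 1 else 0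

/-- **Associativity of carrying**: `carry(b,d) + carry(a, b+d) = carry(a+b, d) + carry(a,b)` (both
sides count `⌊(a+b+d)/2⌋`).  This is the `2`-cocycle identity of the carry cocycle. [folklore] -/
private theorem bitCarry_assoc (a b d : ZMod 2) :
    bitCarry b d + bitCarry a (b + d) = bitCarry (a + b) d + bitCarry a b := by
  revert a b d
  decide

/-- `carry(0, b) = 0`. [folklore] -/
@[simp] private theorem bitCarry_zero_left (b : ZMod 2) : bitCarry 0 b = 0 := by
  revert b
  decide

/-- `carry(a, 0) = 0`. [folklore] -/
@[simp] private theorem bitCarry_zero_right (a : ZMod 2) : bitCarry a 0 = 0 := by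
  revert a
  decide

/-- `carry(1, 1) = 1`. [folklore] -/
@[simp] private theorem bitCarry_one_one : bitCarry 1 1 = 1 := by
  decide

/-- On the diagonal the carry is the bit itself: `carry(a, a) = [a = 1]`. [folklore] -/
private theorem bitCarry_self (a : ZMod 2) : bitCarry a a = if a = 1 then 1 else 0 := by
  revert a
  decide

/-- In `ℤ/2`, `a + b = 0 ↔ a = b`. [folklore] -/
private theorem ZMod.two_add_eq_zero_iff (a b : ZMod 2) : a + b = 0 ↔ a = b := by
  revert a b
  decide

/-! ### A sum over the orbits of a fixed-point-free involution -/

/-- **A finite sum over a set stable under a fixed-point-free involution `τ`, of terms transforming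
by `f(τ x) = T(f x)` under an additive operator `T`, lies in the image of `1 + T`**: it equals
`y + T y` for some `y` (sum over one element of each orbit `{x, τ x}`).  Used with `T = ρ(c)` for an
involution `c` of `G` acting on the cosets `G/N`. [folklore] -/
private theorem exists_sum_eq_add_of_involutive {α : Type*} [DecidableEq α] {M : Type*} [AddCommMonoid M]
    (T : M →+ M) (τ : α → α) (f : α → M) :
    ∀ (S : Finset α), (∀ x ∈ S, τ x ∈ S) → (∀ x ∈ S, τ (τ x) = x) → (∀ x ∈ S, τ x ≠ x) →
      (∀ x ∈ S, f (τ x) = T (f x)) → ∃ y : M, ∑ x ∈ S, f x = y + T y := by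
  intro S
  induction S using Finset.strongInduction with
  | H S ih =>
    intro hst hinv hfix hf
    rcases S.eq_empty_or_nonempty with rfl | ⟨x₀, hx₀⟩
    · exact ⟨0, by simp⟩
    · -- remove the orbit `{x₀, τ x₀}`
      set S' : Finset α := (S.erase x₀).erase (τ x₀) with hS'
      have hS'sub : S' ⊂ S :=
        lt_of_le_of_lt (Finset.erase_subset _ _) (Finset.erase_ssubset hx₀)
      have hmemS' : ∀ {z}, z ∈ S' ↔ z ∈ S ∧ z ≠ x₀ ∧ z ≠ τ x₀ := by
        intro z
        simp only [hS', Finset.mem_erase]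
        tauto
      have hst' : ∀ z ∈ S', τ z ∈ S' := by
        intro z hz
        obtain ⟨hzS, hz1, hz2⟩ := hmemS'.1 hz
        refine hmemS'.2 ⟨hst z hzS, ?_, ?_⟩
        · intro h
          apply hz2
          rw [← h, hinv z hzS]
        · intro h
          apply hz1
          have := congrArg τ h
          rwa [hinv z hzS, hinv x₀ hx₀] at this
      obtain ⟨y', hy'⟩ := ih S' hS'sub hst' (fun z hz => hinv z (hmemS'.1 hz).1)
        (fun z hz => hfix z (hmemS'.1 hz).1) (fun z hz => hf z (hmemS'.1 hz).1)
      have hτx₀ : τ x₀ ∈ S.erase x₀ := Finset.mem_erase.2 ⟨hfix x₀ hx₀, hst x₀ hx₀⟩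
      have hsum : ∑ x ∈ S, f x = f x₀ + (f (τ x₀) + ∑ x ∈ S', f x) := by
        rw [← Finset.add_sum_erase S f hx₀, ← Finset.add_sum_erase _ f hτx₀]
      refine ⟨f x₀ + y', ?_⟩
      rw [hsum, hy', hf x₀ hx₀, map_add]
      abel

/-! ### The sign of the Schreier elements -/

section Sign

variable {G : Type v} [Group G] (N : Subgroup G) {s : G ⧸ N → G}
  (hs : ∀ x : G ⧸ N, (s x : G ⧸ N) = x) (χ : N →* Multiplicative (ZMod 2))

/-- The **sign** `e(g, x) = χ(s(g • x)⁻¹ g s(x)) ∈ ℤ/2` of the Schreier element of `g` at the coset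
`x`, for a quadratic character `χ` of `N`. [cite: NeukirchSchmidtWingberg2008, I §5] -/
def schreierSign (g : G) (x : G ⧸ N) : ZMod 2 :=
  Multiplicative.toAdd (χ (schreierElt N hs g x))

/-- Unfolding `schreierSign`. [cite: NeukirchSchmidtWingberg2008, I §5] -/
theorem schreierSign_def (g : G) (x : G ⧸ N) :
    schreierSign N hs χ g x = Multiplicative.toAdd (χ (schreierElt N hs g x)) := rfl

/-- **Cocycle rule** `e(g₁ g₂, x) = e(g₁, g₂ • x) + e(g₂, x)` (from `schreierElt_mul`).
[cite: NeukirchSchmidtWingberg2008, I §5] -/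
theorem schreierSign_mul (g₁ g₂ : G) (x : G ⧸ N) :
    schreierSign N hs χ (g₁ * g₂) x = schreierSign N hs χ g₁ (g₂ • x) + schreierSign N hs χ g₂ x := by
  rw [schreierSign, schreierElt_mul, map_mul, toAdd_mul, schreierSign, schreierSign]

/-- `e(1, x) = 0` (the Schreier element of `1` is `1`). [cite: NeukirchSchmidtWingberg2008, I §5] -/
@[simp] theorem schreierSign_one (x : G ⧸ N) : schreierSign N hs χ 1 x = 0 := by
  have h : schreierElt N hs 1 x = 1 := Subtype.ext (by rw [schreierElt_coe, one_smul, mul_one,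
    inv_mul_cancel, Subgroup.coe_one])
  rw [schreierSign, h, map_one, toAdd_one]

/-- For an involution `c` (`c * c = 1`): `e(c, c • x) = e(c, x)` (cocycle rule at `(c, c)` and
`e(1, x) = 0`). [cite: NeukirchSchmidtWingberg2008, I §5] -/
theorem schreierSign_smul_self_of_mul_self {c : G} (hc : c * c = 1) (x : G ⧸ N) :
    schreierSign N hs χ c (c • x) = schreierSign N hs χ c x := by
  have h := schreierSign_mul N hs χ c c x
  rw [hc, schreierSign_one] at h
  exact ((ZMod.two_add_eq_zero_iff _ _).1 h.symm)

/-- At a coset FIXED by `g`, the Schreier element is `s(x)⁻¹ g s(x)`. [cite: NeukirchSchmidtWingberg2008, I §5] -/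
theorem schreierElt_coe_of_smul_eq {g : G} {x : G ⧸ N} (h : g • x = x) :
    ((schreierElt N hs g x : N) : G) = (s x)⁻¹ * g * s x := by
  rw [schreierElt_coe, h]

end Sign

/-! ### The carry cocycle -/

section Carry

variable {R : Type u} [CommRing R] [TopologicalSpace R]
variable {G : Type v} [Group G] [TopologicalSpace G] [IsTopologicalGroup G]
variable (X : TopRep.{v} R G) (N : Subgroup G) [Fintype (G ⧸ N)] {s : G ⧸ N → G}
  (hs : ∀ x : G ⧸ N, (s x : G ⧸ N) = x) (χ : N →* Multiplicative (ZMod 2)) (m : X)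

omit [TopologicalSpace G] [IsTopologicalGroup G] [Fintype (G ⧸ N)] in
include hs in
/-- For `m` fixed by `N`: `g • (s(x) m) = s(g • x) m` (as `g s(x) = s(g • x) · schreierElt`).
[cite: NeukirchSchmidtWingberg2008, I §5] -/
theorem rho_rho_rep (hm : ∀ n : N, X.ρ (n : G) m = m) (g : G) (x : G ⧸ N) :
    X.ρ g (X.ρ (s x) m) = X.ρ (s (g • x)) m := by
  rw [← ρ_mul_apply, ← rep_mul_schreierElt N hs g x, ρ_mul_apply, hm]

/-- The carry cochain `(g, h) ↦ ∑_x carry(e(g, h • x), e(h, x)) · s(g h • x) m` as a bare function.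
[cite: NeukirchSchmidtWingberg2008, I §5] -/
def schreierCarryFun (p : G × G) : X :=
  ∑ x : G ⧸ N, bitCarry (schreierSign N hs χ p.1 (p.2 • x)) (schreierSign N hs χ p.2 x) •
    X.ρ (s ((p.1 * p.2) • x)) m

omit [TopologicalSpace G] [IsTopologicalGroup G] in
/-- Unfolding `schreierCarryFun`. [cite: NeukirchSchmidtWingberg2008, I §5] -/
theorem schreierCarryFun_apply (g h : G) :
    schreierCarryFun X N hs χ m (g, h) =
      ∑ x : G ⧸ N, bitCarry (schreierSign N hs χ g (h • x)) (schreierSign N hs χ h x) •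
        X.ρ (s ((g * h) • x)) m := rfl

/-- **The carry cochain is continuous** (`N` open: `G ⧸ N` is discrete, the Schreier elements and
the translated cosets are continuous in the group variables, and the summand is a function of
finitely many discrete data). [cite: NeukirchSchmidtWingberg2008, I §5] -/
theorem continuous_schreierCarryFun (hN : IsOpen (N : Set G)) (hχ : Continuous χ) :
    Continuous (schreierCarryFun X N hs χ m) := by
  haveI : DiscreteTopology (G ⧸ N) := QuotientGroup.discreteTopology hN
  -- the discrete data `x ↦ (e(g, h • x), e(h, x), (g h) • x)`
  let D : G × G → (G ⧸ N → ZMod 2 × ZMod 2 × (G ⧸ N)) := fun p x =>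
    (schreierSign N hs χ p.1 (p.2 • x), schreierSign N hs χ p.2 x, (p.1 * p.2) • x)
  have hsm : ∀ x : G ⧸ N, Continuous fun g : G => g • x := fun x =>
    continuous_id.smul continuous_const
  have hrep : ∀ x : G ⧸ N, Continuous fun g : G => s (g • x) := fun x =>
    continuous_of_discreteTopology.comp (hsm x)
  have hsch : ∀ x : G ⧸ N, Continuous fun g : G => schreierElt N hs g x := fun x =>
    Continuous.subtype_mk (((hrep x).inv.mul continuous_id).mul continuous_const)
      fun g => schreierElt_mem N hs g x
  have hsign : ∀ x : G ⧸ N, Continuous fun g : G => schreierSign N hs χ g x := fun x =>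
    continuous_toAdd.comp (hχ.comp (hsch x))
  -- joint continuity of `(g, h) ↦ e(g, h • x)`: locally constant in `h • x`
  have hsign2 : ∀ x : G ⧸ N, Continuous fun p : G × G => schreierSign N hs χ p.1 (p.2 • x) := by
    intro x
    have hc : Continuous fun q : G × (G ⧸ N) => schreierSign N hs χ q.1 q.2 := by
      refine continuous_prod_of_discrete_right.2 fun y => hsign y
    exact hc.comp (continuous_fst.prodMk ((hsm x).comp continuous_snd))
  have hD : Continuous D := by
    refine continuous_pi fun x => ?_
    exact ((hsign2 x).prodMk (((hsign x).comp continuous_snd).prodMk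
      ((hsm x).comp (continuous_fst.mul continuous_snd))))
  have e : schreierCarryFun X N hs χ m =
      (fun F : G ⧸ N → ZMod 2 × ZMod 2 × (G ⧸ N) =>
        ∑ x : G ⧸ N, bitCarry (F x).1 (F x).2.1 • X.ρ (s (F x).2.2) m) ∘ D := by
    funext p
    rfl
  rw [e]
  exact continuous_of_discreteTopology.comp hD

omit [TopologicalSpace G] [IsTopologicalGroup G] in
/-- **The carry cochain satisfies the `2`-cocycle identity**
`σ X(τ, υ) + X(σ, τυ) = X(στ, υ) + X(σ, τ)`: after reindexing the last sum by `x ↦ υ • x` and moving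
`σ` inside with `rho_rho_rep`, all four sums run over `s(στυ • x) m` with coefficients
`carry(b,d)`, `carry(a, b+d)`, `carry(a+b, d)`, `carry(a, b)` for `a = e(σ, τυ • x)`, `b = e(τ, υ • x)`,
`d = e(υ, x)` — the associativity of carrying. [cite: NeukirchSchmidtWingberg2008, I §5] -/
theorem schreierCarryFun_cocycle (hm : ∀ n : N, X.ρ (n : G) m = m) (σ τ υ : G) :
    X.ρ σ (schreierCarryFun X N hs χ m (τ, υ)) + schreierCarryFun X N hs χ m (σ, τ * υ) =
      schreierCarryFun X N hs χ m (σ * τ, υ) + schreierCarryFun X N hs χ m (σ, τ) := by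
  simp only [schreierCarryFun_apply]
  -- reindex the last sum by `x ↦ υ • x`
  have hre : ∑ x : G ⧸ N, bitCarry (schreierSign N hs χ σ (τ • x)) (schreierSign N hs χ τ x) •
        X.ρ (s ((σ * τ) • x)) m =
      ∑ x : G ⧸ N, bitCarry (schreierSign N hs χ σ (τ • υ • x)) (schreierSign N hs χ τ (υ • x)) •
        X.ρ (s ((σ * τ) • υ • x)) m :=
    (Fintype.sum_equiv (MulAction.toPerm υ) _ _ fun x => rfl).symm
  rw [hre, map_sum, ← Finset.sum_add_distrib, ← Finset.sum_add_distrib]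
  refine Finset.sum_congr rfl fun x _ => ?_
  rw [map_nsmul, rho_rho_rep X N hs m hm, schreierSign_mul, schreierSign_mul]
  -- normalise the cosets
  have h1 : σ • (τ * υ) • x = (σ * τ * υ) • x := by rw [← mul_smul, mul_assoc]
  have h2 : (σ * (τ * υ)) • x = (σ * τ * υ) • x := by rw [mul_assoc]
  have h3 : (σ * τ) • υ • x = (σ * τ * υ) • x := by rw [← mul_smul]
  have h4 : (τ * υ) • x = τ • υ • x := mul_smul τ υ x
  rw [h1, h2, h3, h4, ← add_nsmul, ← add_nsmul, bitCarry_assoc]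

/-- **The carry cocycle** `X_{χ,m} ∈ Z²_cont(G, X)` of the quadratic character `χ` of the open
subgroup `N` of finite index and the `N`-fixed vector `m`:
`X(g, h) = ∑_{x ∈ G/N} carry(e(g, h • x), e(h, x)) · s(g h • x) m`.
Ref: Neukirch–Schmidt–Wingberg I §5–§6; Serre, *Corps locaux* VIII §4.
[cite: NeukirchSchmidtWingberg2008, I §5] -/
def schreierCarryCocycle (hN : IsOpen (N : Set G)) (hχ : Continuous χ) (hm : ∀ n : N, X.ρ (n : G) m = m) :
    contTwoCocycles X :=
  ⟨⟨schreierCarryFun X N hs χ m, continuous_schreierCarryFun X N hs χ m hN hχ⟩,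
    fun σ τ υ => schreierCarryFun_cocycle X N hs χ m hm σ τ υ⟩

variable {hN : IsOpen (N : Set G)} {hχ : Continuous χ} {hm : ∀ n : N, X.ρ (n : G) m = m}

/-- Values of the carry cocycle. [cite: NeukirchSchmidtWingberg2008, I §5] -/
theorem schreierCarryCocycle_apply (g h : G) :
    (schreierCarryCocycle X N hs χ m hN hχ hm).1 (g, h) =
      ∑ x : G ⧸ N, bitCarry (schreierSign N hs χ g (h • x)) (schreierSign N hs χ h x) •
        X.ρ (s ((g * h) • x)) m := rfl

/-- The carry cocycle is normalised: `X(1, 1) = 0`. [cite: NeukirchSchmidtWingberg2008, I §5] -/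
theorem schreierCarryCocycle_one_one : (schreierCarryCocycle X N hs χ m hN hχ hm).1 (1, 1) = 0 := by
  rw [schreierCarryCocycle_apply]
  refine Finset.sum_eq_zero fun x _ => ?_
  rw [schreierSign_one, bitCarry_zero_left, zero_nsmul]

open scoped Classical in
/-- **The diagonal of the carry cocycle at an involution** `c` (`c * c = 1`):
`X(c, c) = ∑_{x : e(c, x) = 1} s(x) m` (as `e(c, c • x) = e(c, x)` and `carry(a, a) = [a = 1]`).
[cite: NeukirchSchmidtWingberg2008, I §5] -/
theorem schreierCarryCocycle_apply_self {c : G} (hc : c * c = 1) :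
    (schreierCarryCocycle X N hs χ m hN hχ hm).1 (c, c) =
      ∑ x ∈ Finset.univ.filter (fun x : G ⧸ N => schreierSign N hs χ c x = 1), X.ρ (s x) m := by
  rw [schreierCarryCocycle_apply, Finset.sum_filter]
  refine Finset.sum_congr rfl fun x _ => ?_
  rw [schreierSign_smul_self_of_mul_self N hs χ hc, bitCarry_self, hc, one_smul]
  split_ifs <;> simp

open scoped Classical in
/-- **The diagonal at an involution splits as the fixed cosets plus a norm**:
`X(c, c) = ∑_{x : c • x = x, e(c,x) = 1} s(x) m + (y + c y)` for some `y` — the cosets moved by `c`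
come in pairs `{x, c • x}` with the same sign and `c · s(x) m = s(c • x) m`
(`exists_sum_eq_add_of_involutive`). [cite: NeukirchSchmidtWingberg2008, I §5] -/
theorem schreierCarryCocycle_diag_eq_sum_fixed_add {c : G} (hc : c * c = 1) :
    ∃ y : X, (schreierCarryCocycle X N hs χ m hN hχ hm).1 (c, c) =
      ∑ x ∈ Finset.univ.filter (fun x : G ⧸ N => c • x = x ∧ schreierSign N hs χ c x = 1),
        X.ρ (s x) m + (y + X.ρ c y) := by
  classical
  rw [schreierCarryCocycle_apply_self X N hs χ m hc]
  set S := Finset.univ.filter (fun x : G ⧸ N => schreierSign N hs χ c x = 1) with hSdef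
  set Sfix := Finset.univ.filter (fun x : G ⧸ N => c • x = x ∧ schreierSign N hs χ c x = 1)
  set Smov := S.filter (fun x : G ⧸ N => c • x ≠ x) with hSmov
  have hsplit : ∑ x ∈ S, X.ρ (s x) m = ∑ x ∈ Sfix, X.ρ (s x) m + ∑ x ∈ Smov, X.ρ (s x) m := by
    rw [← Finset.sum_filter_add_sum_filter_not S (fun x : G ⧸ N => c • x = x)]
    congr 1
    refine Finset.sum_congr ?_ fun _ _ => rfl
    ext x
    simp only [S, Sfix, Finset.mem_filter, Finset.mem_univ, true_and]
    tauto
  have hmemSmov : ∀ {x}, x ∈ Smov ↔ schreierSign N hs χ c x = 1 ∧ c • x ≠ x := by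
    intro x
    simp only [hSmov, S, Finset.mem_filter, Finset.mem_univ, true_and]
  have hcc : ∀ x : G ⧸ N, c • c • x = x := fun x => by rw [← mul_smul, hc, one_smul]
  obtain ⟨y, hy⟩ := exists_sum_eq_add_of_involutive ((X.ρ c : X →L[R] X) : X →+ X)
    (fun x : G ⧸ N => c • x) (fun x => X.ρ (s x) m) Smov
    (fun x hx => by
      obtain ⟨h1, h2⟩ := hmemSmov.1 hx
      refine hmemSmov.2 ⟨?_, ?_⟩
      · rwa [schreierSign_smul_self_of_mul_self N hs χ hc]
      · intro h
        exact h2 (by simpa [hcc x] using congrArg (fun z => c • z) h))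
    (fun x _ => hcc x) (fun x hx => (hmemSmov.1 hx).2)
    (fun x _ => (rho_rho_rep X N hs m hm c x).symm)
  exact ⟨y, by rw [hsplit, hy]; rfl⟩

/-- **Reading 1 (all fixed cosets have sign `0`)**: if `e(c, x) = 0` whenever `c • x = x`, then the
diagonal `X(c, c)` is a norm `y + c y`. [cite: NeukirchSchmidtWingberg2008, I §5] -/
theorem schreierCarryCocycle_diag_of_forall_fixed {c : G} (hc : c * c = 1)
    (h0 : ∀ x : G ⧸ N, c • x = x → schreierSign N hs χ c x = 0) :
    ∃ y : X, (schreierCarryCocycle X N hs χ m hN hχ hm).1 (c, c) = y + X.ρ c y := by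
  classical
  obtain ⟨y, hy⟩ := schreierCarryCocycle_diag_eq_sum_fixed_add X N hs χ m hc (hN := hN) (hχ := hχ) (hm := hm)
  refine ⟨y, ?_⟩
  rw [hy, Finset.sum_eq_zero, zero_add]
  intro x hx
  simp only [Finset.mem_filter, Finset.mem_univ, true_and] at hx
  exact absurd (h0 x hx.1) (by rw [hx.2]; exact one_ne_zero)

/-- **Reading 2 (sign `1` exactly at the unit coset)**: if `c ∈ N` (so the unit coset is fixed),
`e(c, 1·N) = 1`, and `e(c, x) = 0` at every OTHER fixed coset, then `X(c, c) = m + (y + c y)`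
(`s(1·N) ∈ N` fixes `m`). [cite: NeukirchSchmidtWingberg2008, I §5] -/
theorem schreierCarryCocycle_diag_of_unit {c : G} (hc : c * c = 1)
    (h1 : schreierSign N hs χ c ((1 : G) : G ⧸ N) = 1)
    (h0 : ∀ x : G ⧸ N, c • x = x → x ≠ ((1 : G) : G ⧸ N) → schreierSign N hs χ c x = 0)
    (hcN : c ∈ N) :
    ∃ y : X, (schreierCarryCocycle X N hs χ m hN hχ hm).1 (c, c) = m + (y + X.ρ c y) := by
  classical
  obtain ⟨y, hy⟩ := schreierCarryCocycle_diag_eq_sum_fixed_add X N hs χ m hc (hN := hN) (hχ := hχ) (hm := hm)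
  refine ⟨y, ?_⟩
  have hfix1 : c • ((1 : G) : G ⧸ N) = ((1 : G) : G ⧸ N) := smul_mk_one_of_mem N hcN
  have hset : Finset.univ.filter (fun x : G ⧸ N => c • x = x ∧ schreierSign N hs χ c x = 1) =
      {((1 : G) : G ⧸ N)} := by
    ext x
    simp only [Finset.mem_filter, Finset.mem_univ, true_and, Finset.mem_singleton]
    constructor
    · rintro ⟨hx, hx1⟩
      by_contra hne
      exact absurd (h0 x hx hne) (by rw [hx1]; exact one_ne_zero)
    · rintro rfl
      exact ⟨hfix1, h1⟩
  have hs1 : s ((1 : G) : G ⧸ N) ∈ N := by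
    have h := QuotientGroup.eq.mp (hs ((1 : G) : G ⧸ N))
    rw [mul_one] at h
    exact N.inv_mem_iff.mp h
  rw [hy, hset, Finset.sum_singleton, hm ⟨_, hs1⟩]

end Carry

end Literature.NumberTheory.GaloisRepresentations

end
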